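import Summits.BirchSwinnertonDyer.BirchSwinnertonDyer.Theorems.AlignedTransportAtTwoMainConjectureOfRankZeroBSDAtTwoLayerValueDoublyDark
import HarnessLib

/-!
# Route `AlignedTransportAtTwo`, crux C2 `MainConjectureOfRankZeroBSDAtTwo` (stmt-BirchSwinnertonDyer-22298):
# THE DISTINGUISHED POLYNOMIAL OF AN `ι`-STABLE ELEMENT IS SELF-RECIPROCAL IN `1 + T` — for `F ∈ ℤ_p⟦T⟧`, `F ≢ 0 (mod p)`, `F(0) ≠ 0`,
# `(ι F) = (F)`: `(1+T)^λ · ι(P) = P` and `P(−1) = 1` (`P` the distinguished polynomial, `λ = deg P`); hence `λ` odd ⟹ `P(−2) = 0` (any `p`)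

HONEST FRAMING (cell `bsd-f1-sign2`, WIDTH-5 attached prover seat `bsd-line-att-p5` gen 50 on line `birth` of the lead
`bsd-line-att-p2`; `--supports` stmt-BirchSwinnertonDyer-22298, closes nothing; BSD is NOT proved by any of this; the crux C2, its
verdict «blocked-on `Rank1Residual.GreenbergMuConjectureIrreducible`» and every registered stub are untouched). THEOREMS ONLY — pure Λ-algebra,
any prime `p`; no `def`, no instance, no named fact, no `sorry`. Generalises §1 of the sibling `…LayerValueDoublyDark` (`λ = 2`: `T² + qT + q`) to
every `λ`, by the same argument: Mathlib's uniqueness of the Weierstrass factorisation + the tree's `ι T·(1+T) = −T`.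

THE POINT. In the variable `X = 1 + T` the involution is `X ↦ X⁻¹`, and an ideal `(F)` with `F(0) ≠ 0` is `ι`-stable iff the distinguished polynomial
`P̃(X) = P(X − 1)` is PALINDROMIC (`X^λ P̃(1/X) = P̃(X)`). Root-free, in `Λ`:
* `one_add_X_pow_mul_invol_coe`: for ANY polynomial `P = ∑_{k ≤ d} a_k T^k`, **`(1+T)^d · ι(P) = Q_d(P) := ∑_k a_k (−T)^k (1+T)^{d−k}`** (a polynomial of
  degree `≤ d` with top coefficient `P(−1)` and constant coefficient `a₀`; `coeff_reciprocal_top`, `coeff_reciprocal_zero`, `natDegree_reciprocal_le`).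
* ★★★ `eval_neg_one_and_invol_weierstrassDistinguished`: `F ≢ 0 (mod p)`, `F(0) ≠ 0`, `ι F = u·F` ⟹ **`P(−1) = 1` and `(1+T)^λ · ι(P) = P`** in `Λ`
  (`Q = P·w` by `ι`-stability; `Q = (c⁻¹Q)·c` with `c = P(−1) ≡ (−1)^λ (mod p)` a unit and `c⁻¹Q` distinguished ⟹ `c⁻¹Q = P` ⟹ `c = 1`).
* ★★ `eval_neg_two_weierstrassDistinguished_eq_zero_of_odd`: at the second fixed point `T = −2` (`X = −1`) the identity reads
  `P(−2) = (−1)^λ P(−2)`, so **`λ` odd ⟹ `P(−2) = 0`** (i.e. `(T + 2) ∣ F`) — the structural form, for every `p`, of the `p = 2` parity «`ι`-stable,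
  `F(0)F(−2) ≠ 0 ⟹ λ even» (g33 S64t / g49 `even_lam_of_iotaStable`, proved there by other means).
Why it matters here: the coefficient relations it imposes (`λ = 2`: `p₀ = p₁`; `λ = 4`: `p₁ = 2p₀`, `p₀ = p₂ − p₃`; …) are what sorts the lineage's
two fixed-point values `(ord₂F(0), ord₂F(−2)) = (v(P̃(1)), v(P̃(−1)))` and the layer values `v(P̃(ζ))` by `λ` (memo
`Cruxes/MainConjectureOfRankZeroBSDAtTwo/LAYER-VALUE-att-p5-g50.md` §5 (ii)). BSD is not proved by any of this.

References: L. Washington, GTM 83, §7.1 (Weierstrass preparation, uniqueness) [Washington1997]; B. Mazur, J. Tate, J. Teitelbaum, Invent. Math. 84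
(1986) Ch. I §17 [MazurTateTeitelbaum1986Invent]; R. Greenberg, LNM 1716 (1999), §1 pp. 67–68, §5 p. 181 [GreenbergLNM1716].
-/

set_option linter.dupNamespace false
set_option autoImplicit false

noncomputable section

open scoped Classical

namespace Summit.BirchSwinnertonDyer.BirchSwinnertonDyer.Theorems.AlignedTransportAtTwoLayerValuePalindrome

open PowerSeries Literature.NumberTheory.EllipticCurves
  Literature.NumberTheory.EllipticCurves.IwasawaAlgebra
  Summit.BirchSwinnertonDyer.Rank1Residual
  Summit.BirchSwinnertonDyer.Rank1Residual.X1.MuLambda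
  Summit.BirchSwinnertonDyer.Rank1Residual.Iwasawa
  Summit.BirchSwinnertonDyer.Rank1Residual.Supersingular
  Summit.BirchSwinnertonDyer.Rank1Residual.Supersingular.BlindLever
  Summit.BirchSwinnertonDyer.BirchSwinnertonDyer.Theorems.AlignedTransportAtTwoLayerValueDoublyDark

variable {p : ℕ} [hp : Fact p.Prime]

/-! ## §1 The reciprocal polynomial `Q_d(P) = ∑ a_k (−T)^k (1+T)^{d−k}` -/

section Reciprocal

/-- **`(1+T)^d · ι(P) = ∑_{k ≤ d} a_k (−T)^k (1+T)^{d−k}`** in `Λ` for every polynomial `P = ∑ a_k T^k` of degree `≤ d` (from `ι T·(1+T) = −T`).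
[cite: MazurTateTeitelbaum1986Invent, Ch. I §17] -/
theorem one_add_X_pow_mul_invol_coe (P : Polynomial ℤ_[p]) {d : ℕ} (hd : P.natDegree ≤ d) :
    ((1 : IwasawaAlgebra p) + X) ^ d * invol p (P : IwasawaAlgebra p) =
      ((∑ k ∈ Finset.range (d + 1), Polynomial.C (P.coeff k) * (-Polynomial.X) ^ k * (1 + Polynomial.X) ^ (d - k) :
        Polynomial ℤ_[p]) : IwasawaAlgebra p) := by
  have hS : invol p PowerSeries.X * (1 + PowerSeries.X) = -PowerSeries.X := invol_X_mul_one_add_X p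
  have hcoe : ∀ (g : ℕ → Polynomial ℤ_[p]) (s : Finset ℕ),
      ((∑ i ∈ s, g i : Polynomial ℤ_[p]) : IwasawaAlgebra p) = ∑ i ∈ s, ((g i : Polynomial ℤ_[p]) : IwasawaAlgebra p) := by
    intro g s
    rw [← Polynomial.coeToPowerSeries.ringHom_apply, map_sum]
    simp only [Polynomial.coeToPowerSeries.ringHom_apply]
  have hP : (P : IwasawaAlgebra p) = ∑ k ∈ Finset.range (d + 1), PowerSeries.C (P.coeff k) * X ^ k := by
    conv_lhs => rw [P.as_sum_range' (d + 1) (by omega)]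
    rw [hcoe]
    refine Finset.sum_congr rfl fun k _ ↦ ?_
    rw [← Polynomial.C_mul_X_pow_eq_monomial, Polynomial.coe_mul, Polynomial.coe_pow, Polynomial.coe_C, Polynomial.coe_X]
  have hQ : ((∑ k ∈ Finset.range (d + 1), Polynomial.C (P.coeff k) * (-Polynomial.X) ^ k * (1 + Polynomial.X) ^ (d - k) :
        Polynomial ℤ_[p]) : IwasawaAlgebra p) =
      ∑ k ∈ Finset.range (d + 1), PowerSeries.C (P.coeff k) * (-X) ^ k * (1 + X) ^ (d - k) := by
    rw [hcoe]
    refine Finset.sum_congr rfl fun k _ ↦ ?_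
    push_cast
    rfl
  rw [hP, hQ, map_sum, Finset.mul_sum]
  refine Finset.sum_congr rfl fun k hk ↦ ?_
  rw [Finset.mem_range] at hk
  rw [map_mul, map_pow, invol_C]
  have hsplit : ((1 : IwasawaAlgebra p) + X) ^ d = (1 + X) ^ k * (1 + X) ^ (d - k) := by
    rw [← pow_add]; congr 1; omega
  rw [hsplit]
  have hk' : (invol p X) ^ k * ((1 : IwasawaAlgebra p) + X) ^ k = (-X) ^ k := by rw [← mul_pow, hS]
  calc (1 + X) ^ k * (1 + X) ^ (d - k) * (PowerSeries.C (P.coeff k) * invol p X ^ k)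
      = PowerSeries.C (P.coeff k) * (invol p X ^ k * (1 + X) ^ k) * (1 + X) ^ (d - k) := by ring
    _ = PowerSeries.C (P.coeff k) * (-X) ^ k * (1 + X) ^ (d - k) := by rw [hk']

/-- `Q_d(P)` has degree `≤ d`. [folklore] -/
theorem natDegree_reciprocal_le (a : ℕ → ℤ_[p]) (d : ℕ) :
    (∑ k ∈ Finset.range (d + 1), Polynomial.C (a k) * (-Polynomial.X) ^ k * (1 + Polynomial.X) ^ (d - k) : Polynomial ℤ_[p]).natDegree ≤ d := by
  refine Polynomial.natDegree_sum_le_of_forall_le _ _ fun k hk ↦ ?_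
  rw [Finset.mem_range] at hk
  have h1 : ((-Polynomial.X : Polynomial ℤ_[p]) ^ k).natDegree ≤ k := by
    calc ((-Polynomial.X : Polynomial ℤ_[p]) ^ k).natDegree ≤ k * (-Polynomial.X : Polynomial ℤ_[p]).natDegree := Polynomial.natDegree_pow_le
      _ ≤ k * 1 := by rw [Polynomial.natDegree_neg, Polynomial.natDegree_X]
      _ = k := mul_one k
  have h2 : (((1 : Polynomial ℤ_[p]) + Polynomial.X) ^ (d - k)).natDegree ≤ d - k := by
    calc (((1 : Polynomial ℤ_[p]) + Polynomial.X) ^ (d - k)).natDegree ≤ (d - k) * ((1 : Polynomial ℤ_[p]) + Polynomial.X).natDegree :=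
          Polynomial.natDegree_pow_le
      _ ≤ (d - k) * 1 := by
          gcongr
          calc ((1 : Polynomial ℤ_[p]) + Polynomial.X).natDegree ≤ max (1 : Polynomial ℤ_[p]).natDegree Polynomial.X.natDegree :=
                Polynomial.natDegree_add_le _ _
            _ ≤ 1 := by rw [Polynomial.natDegree_one, Polynomial.natDegree_X]; simp
      _ = d - k := mul_one _
  calc (Polynomial.C (a k) * (-Polynomial.X) ^ k * (1 + Polynomial.X) ^ (d - k)).natDegree
      ≤ (Polynomial.C (a k) * (-Polynomial.X) ^ k).natDegree + ((1 + Polynomial.X) ^ (d - k)).natDegree := Polynomial.natDegree_mul_le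
    _ ≤ ((-Polynomial.X) ^ k).natDegree + ((1 + Polynomial.X) ^ (d - k)).natDegree := by
        gcongr; exact Polynomial.natDegree_C_mul_le _ _
    _ ≤ k + (d - k) := add_le_add h1 h2
    _ = d := by omega

/-- The coefficient of `T^d` in `C a · (−T)^k (1+T)^{d−k}` is `a·(−1)^k` (`k ≤ d`). [folklore] -/
theorem coeff_term_top (a : ℤ_[p]) {k d : ℕ} (hk : k ≤ d) :
    (Polynomial.C a * (-Polynomial.X) ^ k * (1 + Polynomial.X) ^ (d - k) : Polynomial ℤ_[p]).coeff d = a * (-1) ^ k := by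
  have hneg : (-Polynomial.X : Polynomial ℤ_[p]) ^ k = Polynomial.C ((-1 : ℤ_[p]) ^ k) * Polynomial.X ^ k := by
    rw [neg_eq_neg_one_mul, mul_pow, ← Polynomial.C_1, ← Polynomial.C_neg, ← Polynomial.C_pow]
  rw [hneg, ← mul_assoc, ← Polynomial.C_mul, mul_assoc, Polynomial.coeff_C_mul, mul_comm (Polynomial.X ^ k),
    show d = (d - k) + k by omega, Polynomial.coeff_mul_X_pow, Polynomial.coeff_one_add_X_pow, Nat.sub_add_cancel hk,
    Nat.choose_self, Nat.cast_one, mul_one]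

/-- The top coefficient of `Q_d(P)` is `P(−1)` when `deg P ≤ d`. [folklore] -/
theorem coeff_reciprocal_top (P : Polynomial ℤ_[p]) {d : ℕ} (hd : P.natDegree ≤ d) :
    (∑ k ∈ Finset.range (d + 1), Polynomial.C (P.coeff k) * (-Polynomial.X) ^ k * (1 + Polynomial.X) ^ (d - k) : Polynomial ℤ_[p]).coeff d =
      P.eval (-1) := by
  rw [Polynomial.finsetSum_coeff, Polynomial.eval_eq_sum_range' (Nat.lt_succ_of_le hd)]
  refine Finset.sum_congr rfl fun k hk ↦ ?_
  rw [Finset.mem_range] at hk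
  rw [coeff_term_top (P.coeff k) (Nat.le_of_lt_succ hk)]

/-- The constant coefficient of `Q_d(P)` is `P(0) = a₀`. [folklore] -/
theorem coeff_reciprocal_zero (P : Polynomial ℤ_[p]) (d : ℕ) :
    (∑ k ∈ Finset.range (d + 1), Polynomial.C (P.coeff k) * (-Polynomial.X) ^ k * (1 + Polynomial.X) ^ (d - k) : Polynomial ℤ_[p]).coeff 0 =
      P.coeff 0 := by
  rw [Polynomial.coeff_zero_eq_eval_zero, Polynomial.eval_finsetSum]
  simp only [Polynomial.eval_mul, Polynomial.eval_C, Polynomial.eval_pow, Polynomial.eval_neg, Polynomial.eval_X, neg_zero,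
    Polynomial.eval_add, Polynomial.eval_one, add_zero, one_pow, mul_one]
  rw [Finset.sum_eq_single 0 (fun k _ hk ↦ by rw [zero_pow hk, mul_zero]) (fun h ↦ absurd (Finset.mem_range.mpr (Nat.succ_pos d)) h),
    pow_zero, mul_one]

/-- For a distinguished `P` of degree `d`, the lower coefficients of `Q_d(P)` lie in the maximal ideal (`Q_d(P) ≡ (−T)^d (mod 𝔪)`). [folklore] -/
theorem coeff_reciprocal_mem {P : Polynomial ℤ_[p]} (hP : P.IsDistinguishedAt (IsLocalRing.maximalIdeal ℤ_[p])) {i : ℕ} (hi : i < P.natDegree) :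
    (∑ k ∈ Finset.range (P.natDegree + 1), Polynomial.C (P.coeff k) * (-Polynomial.X) ^ k * (1 + Polynomial.X) ^ (P.natDegree - k) :
      Polynomial ℤ_[p]).coeff i ∈ IsLocalRing.maximalIdeal ℤ_[p] := by
  rw [Polynomial.finsetSum_coeff]
  refine Ideal.sum_mem _ fun k hk ↦ ?_
  rw [Finset.mem_range] at hk
  rcases (Nat.le_of_lt_succ hk).lt_or_eq with hlt | heq
  · rw [mul_assoc, Polynomial.coeff_C_mul]
    exact Ideal.mul_mem_right _ _ (hP.mem hlt)
  · subst heq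
    rw [hP.monic.coeff_natDegree, map_one, one_mul, Nat.sub_self, pow_zero, mul_one, neg_eq_neg_one_mul, mul_pow,
      ← Polynomial.C_1, ← Polynomial.C_neg, ← Polynomial.C_pow, Polynomial.coeff_C_mul, Polynomial.coeff_X_pow, if_neg hi.ne, mul_zero]
    exact Ideal.zero_mem _

end Reciprocal

/-! ## §2 `ι`-stability makes the distinguished polynomial self-reciprocal -/

section Palindrome

/-- ★★★ **THE DISTINGUISHED POLYNOMIAL OF AN `ι`-STABLE ELEMENT IS SELF-RECIPROCAL.** `F ∈ Λ = ℤ_p⟦T⟧` with `F ≢ 0 (mod p)`, `F(0) ≠ 0` and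
`ι F = u·F` (`u ∈ Λˣ`); `P` its distinguished polynomial, `λ = deg P`. Then **`P(−1) = 1`** and **`(1+T)^λ · ι(P) = P`** in `Λ`; in the variable
`X = 1 + T`, `P̃(X) = P(X−1)` is palindromic: `X^λ P̃(1/X) = P̃(X)`. [cite: Washington1997, §7.1 (Weierstrass preparation, uniqueness)]
[cite: MazurTateTeitelbaum1986Invent, Ch. I §17] -/
theorem eval_neg_one_and_invol_weierstrassDistinguished {F : IwasawaAlgebra p} (hred : F.map (IsLocalRing.residue ℤ_[p]) ≠ 0)
    (h0 : PowerSeries.constantCoeff F ≠ 0) (hι : ∃ u : (IwasawaAlgebra p)ˣ, invol p F = u * F) :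
    (F.weierstrassDistinguished hred).eval (-1) = 1 ∧
      ((1 : IwasawaAlgebra p) + X) ^ (F.weierstrassDistinguished hred).natDegree *
          invol p (F.weierstrassDistinguished hred : IwasawaAlgebra p) = (F.weierstrassDistinguished hred : IwasawaAlgebra p) := by
  set P : Polynomial ℤ_[p] := F.weierstrassDistinguished hred with hP
  set h : IwasawaAlgebra p := F.weierstrassUnit hred with hh
  have hPd : P.IsDistinguishedAt (IsLocalRing.maximalIdeal ℤ_[p]) := F.isDistinguishedAt_weierstrassDistinguished hred
  have hhU : IsUnit h := F.isUnit_weierstrassUnit hred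
  have hfac : F = (P : IwasawaAlgebra p) * h := F.eq_weierstrassDistinguished_mul_weierstrassUnit hred
  set d : ℕ := P.natDegree with hd
  set Q : Polynomial ℤ_[p] :=
    ∑ k ∈ Finset.range (d + 1), Polynomial.C (P.coeff k) * (-Polynomial.X) ^ k * (1 + Polynomial.X) ^ (d - k) with hQ
  have hkey : ((1 : IwasawaAlgebra p) + X) ^ d * invol p (P : IwasawaAlgebra p) = (Q : IwasawaAlgebra p) :=
    one_add_X_pow_mul_invol_coe P le_rfl
  -- `p₀ ≠ 0`
  have hp₀ne : P.coeff 0 ≠ 0 := by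
    intro h0'
    apply h0
    rw [hfac, map_mul, Polynomial.constantCoeff_coe, h0', zero_mul]
  -- first Weierstrass factorisation of `Q`: `Q = P · ((1+T)^d u h (ι h)⁻¹)`
  obtain ⟨u, hu⟩ := hι
  have hιh : IsUnit (invol p h) := hhU.map (invol p)
  have h1X : IsUnit ((1 : IwasawaAlgebra p) + X) := by
    rw [PowerSeries.isUnit_iff_constantCoeff, map_add, map_one, constantCoeff_X, add_zero]
    exact isUnit_one
  set ih : IwasawaAlgebra p := ((hιh.unit⁻¹ : (IwasawaAlgebra p)ˣ) : IwasawaAlgebra p) with hih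
  have hihU : IsUnit ih := Units.isUnit _
  have hih1 : invol p h * ih = 1 := by rw [hih]; exact IsUnit.mul_val_inv hιh
  have hιP : invol p (P : IwasawaAlgebra p) = (u : IwasawaAlgebra p) * ((P : IwasawaAlgebra p) * h) * ih := by
    have e1 : invol p F = invol p (P : IwasawaAlgebra p) * invol p h := by rw [hfac, map_mul]
    calc invol p (P : IwasawaAlgebra p)
        = invol p (P : IwasawaAlgebra p) * (invol p h * ih) := by rw [hih1, mul_one]
      _ = (invol p (P : IwasawaAlgebra p) * invol p h) * ih := by ring
      _ = (u : IwasawaAlgebra p) * ((P : IwasawaAlgebra p) * h) * ih := by rw [← e1, hu, hfac]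
  set w : IwasawaAlgebra p := ((1 : IwasawaAlgebra p) + X) ^ d * (u : IwasawaAlgebra p) * h * ih with hw
  have hwU : IsUnit w := (((h1X.pow d).mul u.isUnit).mul hhU).mul hihU
  have hQ1 : (Q : IwasawaAlgebra p).IsWeierstrassFactorization P w := by
    refine ⟨hPd, hwU, ?_⟩
    rw [← hkey, hιP, hw]; ring
  -- the top coefficient `c = P(−1)` is a unit: `c ≡ (−1)^d (mod 𝔪)`
  set c : ℤ_[p] := P.eval (-1) with hc
  have hQd : Q.coeff d = c := coeff_reciprocal_top P le_rfl
  have hQ0 : Q.coeff 0 = P.coeff 0 := coeff_reciprocal_zero P d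
  have hQle : Q.natDegree ≤ d := natDegree_reciprocal_le (fun k ↦ P.coeff k) d
  have hcU : IsUnit c := by
    -- `c - (-1)^d = ∑_{k<d} a_k (-1)^k ∈ 𝔪`
    have hsum : c = (∑ k ∈ Finset.range d, P.coeff k * (-1) ^ k) + (-1) ^ d := by
      rw [hc, Polynomial.eval_eq_sum_range, ← hd, Finset.sum_range_succ, hPd.monic.coeff_natDegree, one_mul]
    have hmem : c - (-1) ^ d ∈ IsLocalRing.maximalIdeal ℤ_[p] := by
      rw [hsum, add_sub_cancel_right]
      refine Ideal.sum_mem _ fun k hk ↦ Ideal.mul_mem_right _ _ (hPd.mem ?_)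
      rw [Finset.mem_range] at hk; rw [← hd]; exact hk
    by_contra hcn
    have hcm : c ∈ IsLocalRing.maximalIdeal ℤ_[p] := (IsLocalRing.mem_maximalIdeal c).mpr (mem_nonunits_iff.mpr hcn)
    have h1 : ((-1 : ℤ_[p]) ^ d) ∈ IsLocalRing.maximalIdeal ℤ_[p] := by
      have : ((-1 : ℤ_[p]) ^ d) = c - (c - (-1) ^ d) := by ring
      rw [this]; exact Ideal.sub_mem _ hcm hmem
    exact (IsLocalRing.maximalIdeal.isMaximal ℤ_[p]).ne_top
      (Ideal.eq_top_of_isUnit_mem _ h1 ((isUnit_one.neg).pow d))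
  obtain ⟨cu, hcu⟩ := hcU
  have hinv : (↑cu⁻¹ : ℤ_[p]) * c = 1 := by rw [← hcu, Units.inv_mul]
  have hcne : c ≠ 0 := by rw [← hcu]; exact cu.ne_zero
  have hQdeg : Q.natDegree = d := by
    refine le_antisymm hQle ?_
    exact Polynomial.le_natDegree_of_ne_zero (by rw [hQd]; exact hcne)
  -- second Weierstrass factorisation: `Q = (c⁻¹ Q) · c`
  set P₂ : Polynomial ℤ_[p] := Polynomial.C (↑cu⁻¹ : ℤ_[p]) * Q with hP₂
  have hP₂deg : P₂.natDegree = d := by rw [hP₂, Polynomial.natDegree_C_mul (Units.ne_zero _), hQdeg]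
  have hP₂d : P₂.IsDistinguishedAt (IsLocalRing.maximalIdeal ℤ_[p]) := by
    refine ⟨⟨fun {n} hn ↦ ?_⟩, ?_⟩
    · rw [hP₂deg] at hn
      rw [hP₂, Polynomial.coeff_C_mul]
      exact Ideal.mul_mem_left _ _ (coeff_reciprocal_mem hPd (by rw [← hd]; exact hn))
    · rw [Polynomial.Monic, Polynomial.leadingCoeff, hP₂deg, hP₂, Polynomial.coeff_C_mul, hQd, hinv]
  have hQ2fac : (Q : IwasawaAlgebra p).IsWeierstrassFactorization P₂ (PowerSeries.C c) := by
    refine ⟨hP₂d, ?_, ?_⟩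
    · rw [PowerSeries.isUnit_iff_constantCoeff, constantCoeff_C, ← hcu]; exact Units.isUnit _
    · have : Q = P₂ * Polynomial.C c := by
        rw [hP₂, mul_comm (Polynomial.C _) Q, mul_assoc, ← Polynomial.C_mul, hinv, map_one, mul_one]
      conv_lhs => rw [this]
      rw [Polynomial.coe_mul, Polynomial.coe_C]
  -- uniqueness: `P = P₂ = c⁻¹ Q`; constant terms give `c = 1`
  obtain ⟨hPP₂, -⟩ := hQ1.elim hQ2fac
  have h00 : P.coeff 0 = ↑cu⁻¹ * P.coeff 0 := by
    have := congrArg (fun R : Polynomial ℤ_[p] ↦ R.coeff 0) hPP₂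
    have e : P₂.coeff 0 = ↑cu⁻¹ * P.coeff 0 := by rw [hP₂, Polynomial.coeff_C_mul, hQ0]
    exact this.trans e
  have hcu1 : (↑cu⁻¹ : ℤ_[p]) = 1 := by
    have : (1 - ↑cu⁻¹) * P.coeff 0 = 0 := by rw [sub_mul, one_mul, ← h00, sub_self]
    rcases mul_eq_zero.mp this with h1 | h1
    · exact (sub_eq_zero.mp h1).symm
    · exact absurd h1 hp₀ne
  have hc1 : c = 1 := by rw [← hinv, hcu1, one_mul]
  refine ⟨hc1, ?_⟩
  -- `Q = P₂ = P`
  have hQP : Q = P := by rw [hPP₂, hP₂, hcu1, map_one, one_mul]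
  rw [hkey, hQP]

/-- ★★ **At the second fixed point: `λ` odd ⟹ `P(−2) = 0`.** Same hypotheses; as polynomials `P = Q_λ(P)`, and evaluating at `T = −2`
(`X = −1`) gives `P(−2) = ∑ a_k 2^k (−1)^{λ−k} = (−1)^λ P(−2)`; so for odd `λ`, `2·P(−2) = 0`, **`P(−2) = 0`** — i.e. `(T + 2) ∣ F`: an `ι`-stable
`F` with `F(0) ≠ 0 ≠ F(−2)` has EVEN `λ`, for every `p`, read off the palindromic structure (at `p = 2` this is the parity of g33 S64t / g49
`even_lam_of_iotaStable`, proved there by other means). [cite: GreenbergLNM1716, §5 p. 181] [cite: MazurTateTeitelbaum1986Invent, Ch. I §17] -/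
theorem eval_neg_two_weierstrassDistinguished_eq_zero_of_odd {F : IwasawaAlgebra p} (hred : F.map (IsLocalRing.residue ℤ_[p]) ≠ 0)
    (h0 : PowerSeries.constantCoeff F ≠ 0) (hι : ∃ u : (IwasawaAlgebra p)ˣ, invol p F = u * F)
    (hodd : Odd (F.weierstrassDistinguished hred).natDegree) : (F.weierstrassDistinguished hred).eval (-2) = 0 := by
  set P : Polynomial ℤ_[p] := F.weierstrassDistinguished hred with hP
  set d : ℕ := P.natDegree with hd
  obtain ⟨-, hkey⟩ := eval_neg_one_and_invol_weierstrassDistinguished hred h0 hι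
  have hQ := one_add_X_pow_mul_invol_coe P (le_refl d)
  rw [hkey] at hQ
  -- `P = Q_d(P)` as polynomials
  have hPQ : P = ∑ k ∈ Finset.range (d + 1), Polynomial.C (P.coeff k) * (-Polynomial.X) ^ k * (1 + Polynomial.X) ^ (d - k) :=
    Polynomial.coe_inj.mp hQ
  -- evaluate at `−2`: `P(−2) = (−1)^d · P(−2)`
  have hev : P.eval (-2) = (-1) ^ d * P.eval (-2) := by
    conv_lhs => rw [hPQ]
    rw [Polynomial.eval_finsetSum, Polynomial.eval_eq_sum_range, ← hd, Finset.mul_sum]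
    refine Finset.sum_congr rfl fun k hk ↦ ?_
    rw [Finset.mem_range] at hk
    simp only [Polynomial.eval_mul, Polynomial.eval_C, Polynomial.eval_pow, Polynomial.eval_neg, Polynomial.eval_X, neg_neg,
      Polynomial.eval_add, Polynomial.eval_one]
    have h12 : ((1 : ℤ_[p]) + -2) = -1 := by norm_num
    have hsign : ((-1 : ℤ_[p])) ^ d = (-1) ^ (d - k) * (-1) ^ k := by rw [← pow_add, Nat.sub_add_cancel (Nat.le_of_lt_succ hk)]
    have hsq : ((-1 : ℤ_[p])) ^ k * (-1) ^ k = 1 := by rw [← pow_add, ← two_mul, pow_mul]; simp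
    rw [h12]
    calc P.coeff k * (2 : ℤ_[p]) ^ k * (-1) ^ (d - k) = P.coeff k * 2 ^ k * (-1) ^ (d - k) * ((-1) ^ k * (-1) ^ k) := by
          rw [hsq, mul_one]
      _ = ((-1) ^ (d - k) * (-1) ^ k) * (P.coeff k * ((-1) ^ k * 2 ^ k)) := by ring
      _ = (-1) ^ d * (P.coeff k * (-2) ^ k) := by rw [← hsign, ← neg_pow]
  rw [hodd.neg_one_pow, neg_one_mul, eq_neg_iff_add_eq_zero, add_self_eq_zero] at hev
  exact hev

end Palindrome

end Summit.BirchSwinnertonDyer.BirchSwinnertonDyer.Theorems.AlignedTransportAtTwoLayerValuePalindrome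

end
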